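import Summits.HodgeConjecture.HodgeConjecture.Theorems.R90S6TwistedShellSupportBound   -- (T4-NS) FILE A (brings ★ (T4-SYM) `qsInvolution_mem_glInt_iff`, `twistFrame_twistedConj_mem_doubleCoset_neg_rev`,
                                                                                      --   ★ J2′∕W7-f `latt_eq_latt_iff_mem_glInt`, `mem_glInt_iff_isIntMatrix`, ★ L2 `twistFrame_twistFrame`, FILE A §1 tools)
import Literature.NumberTheory.Automorphic.UnitaryLatticeTreeTypes                   -- ★ `isIntMatrix_nonsing_inv_of_v_det_eq_one` (brings ★ `…TreeDual`: `mem_latt_iff_of_isUnit`, `latt_le_latt_iff`)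
import HarnessLib

/-!
# R90 · S6 «Ch. 14.1–14.5 stable trace formula» — card (T4-NS) FILE B (row E1.4.4.2.2): THE NON-SPLIT FIRST SHELL — `τΛ = Λ ∩ γΛ` AND `Λ = τΛ + γ⁻¹τΛ`
# (`Theorems/R90S6TwistedFirstShellNonsplit.lean`)

Cell `hodgecm-mathlib`, crux H413 (`stmt-HodgeConjecture-24833`), route of record `HCCMUnconditional`; programme R90-TF, section S6 (base `R90-C14`, dealer R90-C14-plan (g3)),
seat R90-C14-p04 (g3); card **(T4-NS)** (RULINGS #19 (R54), split «=» RULINGS #36 (R83)), FILE B of two: the heads (T4.6-ii) :255 and (T4.6-iii) :268 of typ2 (g3)'s (T4) SHEET OF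
RECORD v2.3 `…Targets.v2.0f48cf5c7bade6f2.lean` ∕ v2.4 `…70c6fc269e5b0235.lean` §4 (statement bytes identical in both), byte-identical INCLUDING the sheet's
`omit [IsDiscreteValuationRing …] in` — these two heads are DVR-FREE (no `relPos`).  FILE A `Theorems/R90S6TwistedShellSupportBound.lean` carries (T4.5) and (T4.6-i).
Lane `--kind proof --supports stmt-HodgeConjecture-24833 --as helper`; THEOREMS ONLY (no definition, no instance, no notation, no named fact, no kit, no `sorry`).

LETTERS (★ J2′ ∕ ★ L2 ∕ FILE A): `τg := δ′·Θ_σ(g)`, `γ := Nδ′ = δ′·Θ_σ(δ′)` (`τ(τg) = γ·g`, ★ L2 `twistFrame_twistFrame`), `Λ = latt g`, `τΛ = latt (τg)`, `γΛ = latt (γg)` (★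
`latt`: the `𝒪`-lattice spanned by the columns), the shell condition `g⁻¹τg ∈ K̃·ϖ^{(1,0,0)}·K̃`, and FRAMES READ OFF THE SHELL (§1 `exists_frames_of_mem_twistedShell`, any `N`,
any `a`): `Λ = latt f`, `τΛ = latt (f·ϖ^a)` and `τΛ = latt f′`, `γΛ = latt (f′·ϖ^{−w₀a})`.

THE MATHEMATICS ([Macdonald1995] Ch. V §2 (2.6); [Serre1980Trees] II.1.1; [Kottwitz1986BaseChangeUnits] §3):
* §0 (generic, any `N`, no DVR) `mem_latt_mul_zpowDiagGL_iff` (coordinates of `latt (f·ϖ^a)`), `latt_mul_eq_latt_of_mem_glInt` (`latt (f·k) = latt f`, `k ∈ K̃`), `latt_twistFrame_eq_latt_twistFrame_iff` (`τ` is injective on lattices, ★ (T4-SYM) `qsInvolution_mem_glInt_iff`),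
  `latt_eq_latt_of_le_of_v_det_eq` (a sublattice of the same covolume is the whole lattice, ★ `isIntMatrix_nonsing_inv_of_v_det_eq_one`), and the COATOM LEMMA
  **`eq_or_eq_of_latt_mul_zpowDiagGL_single_le`**: `latt (f·ϖ^{e_i}) ≤ M ≤ latt f ⟹ M = latt (f·ϖ^{e_i}) ∨ M = latt f` (`e_i = Pi.single i 1`; a vector of `M` outside
  `latt (f·ϖ^{e_i})` has a UNIT `i`-th `f`-coordinate and then generates `latt f` together with `latt (f·ϖ^{e_i})` — `Λ ∕ ϖ^{e_i}Λ ≅ 𝒪∕ϖ` is simple);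
* §1 `exists_frames_of_mem_twistedShell` (frames of `Λ, τΛ, γΛ` from the shell condition, Mathlib `DoubleCoset.mem_doubleCoset` + ★ (T4-SYM) `twistFrame_twistedConj_mem_doubleCoset_neg_rev`);
* §2 **(T4.6-ii) `latt_twistFrame_eq_inf_of_mem_twistedShell_one_zero_zero`**: `τΛ ≤ Λ ⊓ γΛ ≤ Λ` ⇒ (COATOM) `Λ ⊓ γΛ ∈ {τΛ, Λ}`; `= Λ` would give `τΛ ≤ Λ ≤ γΛ` ⇒ (COATOM in the
  `γ`-side frame) `Λ ∈ {τΛ, γΛ}` — `τΛ ≠ Λ` (`ϖ⁻¹ ∉ 𝒪`) and `γΛ ≠ Λ` (`hne`);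
* §3 **(T4.6-iii) `latt_eq_sup_of_mem_twistedShell_one_zero_zero`**: `τΛ ≤ τΛ ⊔ γ⁻¹τΛ ≤ Λ` ⇒ (COATOM) `∈ {τΛ, Λ}`; `= τΛ` ⇒ `γ⁻¹τΛ ≤ τΛ` ⇒ EQUAL (same covolume) ⇒
  `τ(γΛ) = γ·τΛ = τΛ = τ(Λ)` (`τ∘γ = γ∘τ` on frames, `Θ_σ² = id`) ⇒ `γΛ = Λ` by `τ`-injectivity — contradicting `hne`.
HONEST LABEL: first-shell non-split lattice layer for DAG row E1.4.4.2.2 (the parametrisation `Λ ↔ τΛ` of D1), count-neutral until the D1 values consume it; proves no printed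
global statement, discharges no citation; HC_CM is proved only modulo the 7 printed citations (2 remaining named inputs: hLiu418 = stmt-HodgeConjecture-24832, h413 =
stmt-HodgeConjecture-24833) until rung 0 closes.

## References
* [Macdonald1995] I. G. Macdonald, *Symmetric Functions and Hall Polynomials*, 2nd ed. (1995): Ch. V §2 (2.6) (`G ∕ K` = lattices; sublattices of type `(1,0,…,0)`).
* [Serre1980Trees] J.-P. Serre, *Trees* (1980): Ch. II §1.1 (lattices, `Λ′ ⊆ Λ ⟺ g⁻¹g′` integral, neighbours `ϖΛ ⊂ Λ′ ⊂ Λ`).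
* [Kottwitz1986BaseChangeUnits] R. E. Kottwitz, *Base change for unit elements of Hecke algebras*, Compositio Math. 60 (1986): §1 pp. 240–242, §3 (the twisted action on lattices).
-/

set_option autoImplicit false
-- the mandated namespace repeats the single-problem summit's segment (`HodgeConjecture.HodgeConjecture`)
set_option linter.dupNamespace false

noncomputable section

open scoped Matrix MatrixGroups Valued WithZero Pointwise
open Literature.NumberTheory.Automorphic Literature.NumberTheory.Automorphic.HermitianLattice Literature.NumberTheory.Automorphic.UnitaryLatticeTree

namespace Summit.HodgeConjecture.HodgeConjecture.R90.S6

/-! ## §0 Generic lattice tools (any `N`, no DVR hypothesis) -/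

section Generic

variable {K : Type} [Field K] [Valued K ℤᵐ⁰] [ValuativeRel K] [(Valued.v : Valuation K ℤᵐ⁰).Compatible] {σ : K →+* K} {N : ℕ}
  {ϖ : K} (hϖ : IsUniformizingElement ϖ)

omit [(Valued.v : Valuation K ℤᵐ⁰).Compatible] in
/-- **Coordinates of `latt (f·ϖ^a)`**: `x ∈ (f·ϖ^a)·𝒪^N ⟺ v(ϖ^{−a_i}·(f⁻¹x)_i) ≤ 1` for all `i` (★ `mem_latt_iff_of_isUnit`, `(f·ϖ^a)⁻¹ = ϖ^{−a}·f⁻¹`). [cite: Serre1980Trees, II.1.1] -/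
theorem mem_latt_mul_zpowDiagGL_iff (f : GL (Fin N) K) (a : Fin N → ℤ) (x : Fin N → K) :
    x ∈ latt ((f * zpowDiagGL hϖ.ne_zero a : GL (Fin N) K) : Matrix (Fin N) (Fin N) K) ↔
      ∀ i, Valued.v (ϖ ^ (-a i) * (((f : GL (Fin N) K) : Matrix (Fin N) (Fin N) K)⁻¹.mulVec x) i) ≤ 1 := by
  rw [mem_latt_iff_of_isUnit (Matrix.isUnits_det_units _), mem_stdLattice, ← Matrix.coe_units_inv, mul_inv_rev, ← zpowDiagGL_neg, Units.val_mul,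
    ← Matrix.mulVec_mulVec, coe_zpowDiagGL, Matrix.coe_units_inv]
  simp only [Matrix.mulVec_diagonal, Pi.neg_apply]

omit [Valued K ℤᵐ⁰] [ValuativeRel K] [(Valued.v : Valuation K ℤᵐ⁰).Compatible] in
/-- The columns' coordinates: `f⁻¹·(f·u) = u`. [cite: Serre1980Trees, II.1.1] -/
private theorem inv_mulVec_mulVec (f : GL (Fin N) K) (u : Fin N → K) :
    (((f : GL (Fin N) K) : Matrix (Fin N) (Fin N) K)⁻¹).mulVec ((((f : GL (Fin N) K) : Matrix (Fin N) (Fin N) K)).mulVec u) = u := by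
  rw [Matrix.mulVec_mulVec, Matrix.nonsing_inv_mul _ (Matrix.isUnits_det_units f), Matrix.one_mulVec]

omit [Valued K ℤᵐ⁰] [ValuativeRel K] [(Valued.v : Valuation K ℤᵐ⁰).Compatible] in
/-- `f·(f⁻¹·x) = x`. [cite: Serre1980Trees, II.1.1] -/
private theorem mulVec_inv_mulVec (f : GL (Fin N) K) (x : Fin N → K) :
    (((f : GL (Fin N) K) : Matrix (Fin N) (Fin N) K)).mulVec ((((f : GL (Fin N) K) : Matrix (Fin N) (Fin N) K)⁻¹).mulVec x) = x := by
  rw [Matrix.mulVec_mulVec, Matrix.mul_nonsing_inv _ (Matrix.isUnits_det_units f), Matrix.one_mulVec]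

/-- **`latt (f·k) = latt f` for `k ∈ K̃`** (★ W7-f `latt_eq_latt_iff_mem_glInt`: `f⁻¹(fk) = k`). [cite: Serre1980Trees, II.1.1] -/
theorem latt_mul_eq_latt_of_mem_glInt (f : GL (Fin N) K) {k : GL (Fin N) K} (hk : k ∈ glInt N K) :
    latt ((f * k : GL (Fin N) K) : Matrix (Fin N) (Fin N) K) = latt ((f : GL (Fin N) K) : Matrix (Fin N) (Fin N) K) := by
  refine ((latt_eq_latt_iff_mem_glInt f (f * k)).2 ?_).symm
  rwa [inv_mul_cancel_left]

/-- **`τ` IS INJECTIVE ON LATTICES**: `latt (δ′·Θ_σ a) = latt (δ′·Θ_σ b) ⟺ latt a = latt b` for `σ` valuation-preserving — `(δ′Θ_σa)⁻¹(δ′Θ_σb) = Θ_σ(a⁻¹b) ∈ K̃ ⟺ a⁻¹b ∈ K̃`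
(★ (T4-SYM) `qsInvolution_mem_glInt_iff`, ★ W7-f `latt_eq_latt_iff_mem_glInt`). [cite: Kottwitz1986BaseChangeUnits, §1 p. 240] -/
theorem latt_twistFrame_eq_latt_twistFrame_iff (hvσ : ∀ a, Valued.v (σ a) = Valued.v a) (δ' a b : GL (Fin N) K) :
    latt ((δ' * UnitaryGroup.qsInvolution σ a : GL (Fin N) K) : Matrix (Fin N) (Fin N) K) =
        latt ((δ' * UnitaryGroup.qsInvolution σ b : GL (Fin N) K) : Matrix (Fin N) (Fin N) K) ↔
      latt ((a : GL (Fin N) K) : Matrix (Fin N) (Fin N) K) = latt ((b : GL (Fin N) K) : Matrix (Fin N) (Fin N) K) := by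
  rw [latt_eq_latt_iff_mem_glInt, latt_eq_latt_iff_mem_glInt,
    show (δ' * UnitaryGroup.qsInvolution σ a)⁻¹ * (δ' * UnitaryGroup.qsInvolution σ b) = UnitaryGroup.qsInvolution σ (a⁻¹ * b) by
      rw [UnitaryGroup.qsInvolution_mul, qsInvolution_inv]; group,
    qsInvolution_mem_glInt_iff hvσ]

/-- **A SUBLATTICE OF THE SAME COVOLUME IS THE WHOLE LATTICE**: `latt b ≤ latt a` and `v(det b) = v(det a)` ⟹ `latt b = latt a` — `a⁻¹b` is integral with unit determinant, hence
in `K̃` (★ `isIntMatrix_nonsing_inv_of_v_det_eq_one`, ★ W7-f `mem_glInt_iff_isIntMatrix`). [cite: Serre1980Trees, II.1.1] -/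
theorem latt_eq_latt_of_le_of_v_det_eq (a b : GL (Fin N) K)
    (hle : latt ((b : GL (Fin N) K) : Matrix (Fin N) (Fin N) K) ≤ latt ((a : GL (Fin N) K) : Matrix (Fin N) (Fin N) K))
    (hdet : Valued.v ((b : GL (Fin N) K) : Matrix (Fin N) (Fin N) K).det = Valued.v ((a : GL (Fin N) K) : Matrix (Fin N) (Fin N) K).det) :
    latt ((b : GL (Fin N) K) : Matrix (Fin N) (Fin N) K) = latt ((a : GL (Fin N) K) : Matrix (Fin N) (Fin N) K) := by
  have ha : Valued.v ((a : GL (Fin N) K) : Matrix (Fin N) (Fin N) K).det ≠ 0 := (Valuation.ne_zero_iff _).2 (Matrix.isUnits_det_units a).ne_zero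
  have hint : IsIntMatrix ((a⁻¹ * b : GL (Fin N) K) : Matrix (Fin N) (Fin N) K) := by
    rw [Units.val_mul, Matrix.coe_units_inv]
    exact (latt_le_latt_iff (Matrix.isUnits_det_units a) _).1 hle
  have hd : Valued.v ((a⁻¹ * b : GL (Fin N) K) : Matrix (Fin N) (Fin N) K).det = 1 := by
    rw [Units.val_mul, Matrix.det_mul, map_mul, Matrix.coe_units_inv, Matrix.det_nonsing_inv, Ring.inverse_eq_inv', map_inv₀, hdet, inv_mul_cancel₀ ha]
  have hmem : a⁻¹ * b ∈ glInt N K := by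
    rw [mem_glInt_iff_isIntMatrix]
    refine ⟨hint, ?_⟩
    rw [Matrix.coe_units_inv]
    exact isIntMatrix_nonsing_inv_of_v_det_eq_one hint hd
  exact ((latt_eq_latt_iff_mem_glInt a b).2 hmem).symm

/-- **THE COATOM LEMMA — `Λ ∕ Λ_i` IS SIMPLE**: for a frame `f`, an index `i₀` and `Λ_{i₀} := latt (f·ϖ^{e_{i₀}})` (`e_{i₀} = Pi.single i₀ 1`: the `i₀`-th `f`-coordinate gains one
`ϖ`; `Λ ∕ Λ_{i₀} ≅ 𝒪∕ϖ𝒪`), every `𝒪`-module `M` with `Λ_{i₀} ≤ M ≤ Λ = latt f` is `Λ_{i₀}` or `Λ`: a vector `x ∈ M ∖ Λ_{i₀}` has `f`-coordinate `y_{i₀}` with `v ϖ < v(y_{i₀}) ≤ 1`,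
i.e. a UNIT (`ϖ` generates `𝔪`: `v y < 1 ⇒ v y ≤ v ϖ`, ★ `IsUniformizingElement.exists_eq_mul`), and then every `w = f·z ∈ Λ` is `(z_{i₀}∕y_{i₀})·x + f·(z − (z_{i₀}∕y_{i₀})y)` with the second vector in
`Λ_{i₀}` (its `i₀`-th coordinate vanishes).  [cite: Serre1980Trees, II.1.1] [cite: Macdonald1995, Ch. V §2 (2.6)] -/
theorem eq_or_eq_of_latt_mul_zpowDiagGL_single_le (f : GL (Fin N) K) (i₀ : Fin N) {M : Submodule 𝒪[K] (Fin N → K)}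
    (h₁ : latt ((f * zpowDiagGL hϖ.ne_zero (Pi.single i₀ 1) : GL (Fin N) K) : Matrix (Fin N) (Fin N) K) ≤ M)
    (h₂ : M ≤ latt ((f : GL (Fin N) K) : Matrix (Fin N) (Fin N) K)) :
    M = latt ((f * zpowDiagGL hϖ.ne_zero (Pi.single i₀ 1) : GL (Fin N) K) : Matrix (Fin N) (Fin N) K) ∨
      M = latt ((f : GL (Fin N) K) : Matrix (Fin N) (Fin N) K) := by
  by_cases hM : M ≤ latt ((f * zpowDiagGL hϖ.ne_zero (Pi.single i₀ 1) : GL (Fin N) K) : Matrix (Fin N) (Fin N) K)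
  · exact Or.inl (le_antisymm hM h₁)
  right
  refine le_antisymm h₂ fun w hw => ?_
  obtain ⟨x, hxM, hx⟩ := SetLike.not_le_iff_exists.1 hM
  have hf : IsUnit ((f : GL (Fin N) K) : Matrix (Fin N) (Fin N) K).det := Matrix.isUnits_det_units f
  -- `f`-coordinates `y` of `x` and `z` of `w`, both integral
  have hy : (((f : GL (Fin N) K) : Matrix (Fin N) (Fin N) K)⁻¹).mulVec x ∈ stdLattice K N := (mem_latt_iff_of_isUnit hf x).1 (h₂ hxM)
  have hz : (((f : GL (Fin N) K) : Matrix (Fin N) (Fin N) K)⁻¹).mulVec w ∈ stdLattice K N := (mem_latt_iff_of_isUnit hf w).1 hw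
  generalize hy' : (((f : GL (Fin N) K) : Matrix (Fin N) (Fin N) K)⁻¹).mulVec x = y at hy
  generalize hz' : (((f : GL (Fin N) K) : Matrix (Fin N) (Fin N) K)⁻¹).mulVec w = z at hz
  have hxy : (((f : GL (Fin N) K) : Matrix (Fin N) (Fin N) K)).mulVec y = x := by rw [← hy', mulVec_inv_mulVec]
  have hwz : (((f : GL (Fin N) K) : Matrix (Fin N) (Fin N) K)).mulVec z = w := by rw [← hz', mulVec_inv_mulVec]
  -- `x ∉ Λ_{i₀}` ⟹ the `i₀`-th coordinate of `x` is a unit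
  have hunit : Valued.v (y i₀) = 1 := by
    by_contra hne1
    have hlt : Valued.v (y i₀) < 1 := lt_of_le_of_ne (mem_stdLattice.1 hy i₀) hne1
    apply hx
    rw [mem_latt_mul_zpowDiagGL_iff hϖ, hy']
    intro i
    by_cases hi : i = i₀
    · subst hi
      rw [Pi.single_eq_same, zpow_neg, zpow_one, map_mul, map_inv₀]
      -- `v y < 1 ⟹ v y ≤ v ϖ`: `y` is a multiple of the uniformizing element (★ `IsUniformizingElement.exists_eq_mul` through the ★ `Valued`∕`ValuativeRel` bridge)
      have hle : Valued.v (y i) ≤ Valued.v ϖ := by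
        obtain ⟨z, hz, hzy⟩ := hϖ.exists_eq_mul ((v_le_one_iff_mem_integer (y i)).1 hlt.le) ((v_lt_one_iff_valuation_lt_one (y i)).1 hlt)
        rw [hzy, map_mul]
        exact mul_le_of_le_one_right' ((v_le_one_iff_mem_integer z).2 hz)
      exact (inv_mul_le_one₀ (v_uniformizer_pos hϖ)).2 hle
    · rw [Pi.single_eq_of_ne hi, neg_zero, zpow_zero, one_mul]
      exact mem_stdLattice.1 hy i
  have hy0 : y i₀ ≠ 0 := fun h0 => zero_ne_one (by rw [h0, map_zero] at hunit; exact hunit)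
  -- `w = c·x + f·(z − c·y)` with `c = z_{i₀} ∕ y_{i₀} ∈ 𝒪` and `f·(z − c·y) ∈ Λ_{i₀}`
  have hcv : Valued.v (z i₀ / y i₀) ≤ 1 := by
    rw [map_div₀, hunit, div_one]
    exact mem_stdLattice.1 hz i₀
  have hz1 : ∀ j, Valued.v ((z - (z i₀ / y i₀) • y) j) ≤ 1 := fun j => by
    rw [Pi.sub_apply, Pi.smul_apply, smul_eq_mul]
    refine (Valuation.map_sub _ _ _).trans (max_le (mem_stdLattice.1 hz j) ?_)
    rw [map_mul]
    exact mul_le_one' hcv (mem_stdLattice.1 hy j)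
  have hz0 : (z - (z i₀ / y i₀) • y) i₀ = 0 := by
    rw [Pi.sub_apply, Pi.smul_apply, smul_eq_mul, div_mul_cancel₀ _ hy0, sub_self]
  have hmem : (((f : GL (Fin N) K) : Matrix (Fin N) (Fin N) K)).mulVec (z - (z i₀ / y i₀) • y) ∈
      latt ((f * zpowDiagGL hϖ.ne_zero (Pi.single i₀ 1) : GL (Fin N) K) : Matrix (Fin N) (Fin N) K) := by
    rw [mem_latt_mul_zpowDiagGL_iff hϖ, inv_mulVec_mulVec]
    intro i
    by_cases hi : i = i₀
    · subst hi
      rw [hz0, mul_zero, map_zero]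
      exact zero_le
    · rw [Pi.single_eq_of_ne hi, neg_zero, zpow_zero, one_mul]
      exact hz1 i
  have hw_eq : w = (z i₀ / y i₀) • x + (((f : GL (Fin N) K) : Matrix (Fin N) (Fin N) K)).mulVec (z - (z i₀ / y i₀) • y) := by
    rw [Matrix.mulVec_sub, Matrix.mulVec_smul, hxy, hwz, add_sub_cancel]
  rw [hw_eq]
  exact M.add_mem (M.smul_mem (⟨z i₀ / y i₀, (Valuation.mem_integer_iff _ _).2 hcv⟩ : 𝒪[K]) hxM) (h₁ hmem)

end Generic

/-! ## §1 Frames of `Λ`, `τΛ`, `γΛ` read off the shell condition (any `N`, any `a`) -/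

section Frames

variable {K : Type} [Field K] [Valued K ℤᵐ⁰] [ValuativeRel K] [(Valued.v : Valuation K ℤᵐ⁰).Compatible] {σ : K →+* K} {N : ℕ}
  {ϖ : K} (hϖ : IsUniformizingElement ϖ)

/-- **FRAMES FROM THE SHELL**: if `g⁻¹·τg ∈ K̃·ϖ^a·K̃` (`τg = δ′Θ_σ g`) then there are frames `f, f′` with `Λ = latt g = latt f`, `τΛ = latt (τg) = latt (f·ϖ^a) = latt f′` and
`γΛ = latt (γ·g) = latt (f′·ϖ^{−w₀a})` (`γ = δ′Θ_σδ′`): `τg = g·k₁·ϖ^a·k₂` (Mathlib `DoubleCoset.mem_doubleCoset`), `f := g·k₁`; `(τg)⁻¹·τ(τg) = Θ_σ(g⁻¹τg) = k₃·ϖ^{−w₀a}·k₄` (★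
(T4-SYM) `twistFrame_twistedConj_mem_doubleCoset_neg_rev`, `σ` isometric with `σϖ = ϖ`) and `τ(τg) = γ·g` (★ L2 `twistFrame_twistFrame`, `σ ∘ σ = id`), `f′ := τg·k₃`.
[cite: Kottwitz1986BaseChangeUnits, §3] [cite: Macdonald1995, Ch. V §2 (2.6)] -/
theorem exists_frames_of_mem_twistedShell (hvσ : ∀ a, Valued.v (σ a) = Valued.v a) (hσσ : ∀ a, σ (σ a) = a) (hσϖ : σ ϖ = ϖ) {a : Fin N → ℤ}
    {δ' g : GL (Fin N) K}
    (h : g⁻¹ * δ' * UnitaryGroup.qsInvolution σ g ∈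
      (glInt N K : Set (GL (Fin N) K)) * {zpowDiagGL hϖ.ne_zero a} * (glInt N K : Set (GL (Fin N) K))) :
    ∃ f f' : GL (Fin N) K,
      latt ((g : GL (Fin N) K) : Matrix (Fin N) (Fin N) K) = latt ((f : GL (Fin N) K) : Matrix (Fin N) (Fin N) K) ∧
      latt ((δ' * UnitaryGroup.qsInvolution σ g : GL (Fin N) K) : Matrix (Fin N) (Fin N) K) =
        latt ((f * zpowDiagGL hϖ.ne_zero a : GL (Fin N) K) : Matrix (Fin N) (Fin N) K) ∧
      latt ((δ' * UnitaryGroup.qsInvolution σ g : GL (Fin N) K) : Matrix (Fin N) (Fin N) K) = latt ((f' : GL (Fin N) K) : Matrix (Fin N) (Fin N) K) ∧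
      latt ((δ' * UnitaryGroup.qsInvolution σ δ' * g : GL (Fin N) K) : Matrix (Fin N) (Fin N) K) =
        latt ((f' * zpowDiagGL hϖ.ne_zero (fun i => - a (Fin.rev i)) : GL (Fin N) K) : Matrix (Fin N) (Fin N) K) := by
  obtain ⟨k₁, hk₁, k₂, hk₂, e⟩ := DoubleCoset.mem_doubleCoset.1 h
  obtain ⟨k₃, hk₃, k₄, hk₄, e'⟩ := DoubleCoset.mem_doubleCoset.1 (twistFrame_twistedConj_mem_doubleCoset_neg_rev hϖ hvσ hσϖ δ' h)
  -- `τg = g k₁ ϖ^a k₂` and `γ g = τ(τg) = τg k₃ ϖ^{−w₀a} k₄`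
  have hτ : δ' * UnitaryGroup.qsInvolution σ g = g * k₁ * zpowDiagGL hϖ.ne_zero a * k₂ := by
    rw [mul_assoc g, mul_assoc g, ← e]
    group
  have hγ : δ' * UnitaryGroup.qsInvolution σ δ' * g =
      δ' * UnitaryGroup.qsInvolution σ g * k₃ * zpowDiagGL hϖ.ne_zero (fun i => - a (Fin.rev i)) * k₄ := by
    rw [← twistFrame_twistFrame hσσ δ' g, mul_assoc (δ' * UnitaryGroup.qsInvolution σ g), mul_assoc (δ' * UnitaryGroup.qsInvolution σ g), ← e']
    group
  refine ⟨g * k₁, δ' * UnitaryGroup.qsInvolution σ g * k₃, (latt_mul_eq_latt_of_mem_glInt (g : GL (Fin N) K) hk₁).symm, ?_,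
    (latt_mul_eq_latt_of_mem_glInt _ hk₃).symm, ?_⟩
  · rw [hτ, latt_mul_eq_latt_of_mem_glInt _ hk₂]
  · rw [hγ, latt_mul_eq_latt_of_mem_glInt _ hk₄]

end Frames

/-! ## §2 (T4.6-ii) `τΛ = Λ ∩ γΛ` on the non-split first shell — SHEET v2.3 ∕ v2.4 §4 :255 -/

section FirstShell

variable {K : Type} [Field K] [Valued K ℤᵐ⁰] [ValuativeRel K] [(Valued.v : Valuation K ℤᵐ⁰).Compatible] {σ : K →+* K} {N : ℕ}
  [IsDiscreteValuationRing (ValuativeRel.valuation K).integer] {ϖ : K} (hϖ : IsUniformizingElement ϖ)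

omit [IsDiscreteValuationRing (ValuativeRel.valuation K).integer] in
/-- The first-shell exponent `(1,0,0)` is the coordinate vector `e₀`. [cite: Macdonald1995, Ch. V §2 (2.6)] -/
private theorem vec_one_zero_zero_eq_single : (![1, 0, 0] : Fin 3 → ℤ) = Pi.single 0 1 := by
  funext i
  fin_cases i <;> rfl

omit [IsDiscreteValuationRing (ValuativeRel.valuation K).integer] in
/-- `−w₀(1,0,0) + e₂ = 0`: the `γ`-side frame `f′·ϖ^{−w₀(1,0,0)}` regains `τΛ` by one `ϖ` in the last coordinate. [cite: Macdonald1995, Ch. V §2 (2.6)] -/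
private theorem neg_rev_one_zero_zero_add_single : ((fun i : Fin 3 => -((![1, 0, 0] : Fin 3 → ℤ) (Fin.rev i))) + Pi.single 2 1) = 0 := by
  funext i
  fin_cases i <;> rfl

omit [IsDiscreteValuationRing (ValuativeRel.valuation K).integer] in
/-- `Λ_{i₀} = latt (f·ϖ^{e_{i₀}})` is a PROPER sublattice of `latt f` (`ϖ⁻¹ ∉ 𝒪`). [cite: Serre1980Trees, II.1.1] -/
private theorem latt_mul_zpowDiagGL_single_ne (f : GL (Fin N) K) (i₀ : Fin N) :
    latt ((f * zpowDiagGL hϖ.ne_zero (Pi.single i₀ 1) : GL (Fin N) K) : Matrix (Fin N) (Fin N) K) ≠ latt ((f : GL (Fin N) K) : Matrix (Fin N) (Fin N) K) := by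
  intro h
  have hk := (latt_eq_latt_iff_mem_glInt _ _).1 h
  rw [mul_inv_rev, inv_mul_cancel_right, ← zpowDiagGL_neg, mem_glInt_iff_isIntMatrix] at hk
  have h0 := (isIntMatrix_coe_zpowDiagGL_iff hϖ _).1 hk.1 i₀
  rw [Pi.neg_apply, Pi.single_eq_same] at h0
  omega

omit [IsDiscreteValuationRing (ValuativeRel.valuation K).integer] in
/-- `Λ_{i₀} ≤ latt f` (`ϖ^{e_{i₀}}` is integral). [cite: Serre1980Trees, II.1.1] -/
private theorem latt_mul_zpowDiagGL_single_le (f : GL (Fin N) K) (i₀ : Fin N) :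
    latt ((f * zpowDiagGL hϖ.ne_zero (Pi.single i₀ 1) : GL (Fin N) K) : Matrix (Fin N) (Fin N) K) ≤ latt ((f : GL (Fin N) K) : Matrix (Fin N) (Fin N) K) := by
  rw [latt_le_latt_iff (Matrix.isUnits_det_units _), ← Matrix.coe_units_inv, ← Units.val_mul, inv_mul_cancel_left]
  refine (isIntMatrix_coe_zpowDiagGL_iff hϖ _).2 fun i => ?_
  by_cases hi : i = i₀
  · subst hi
    rw [Pi.single_eq_same]
    exact zero_le_one
  · rw [Pi.single_eq_of_ne hi]

omit [IsDiscreteValuationRing (ValuativeRel.valuation K).integer] in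
/-- **(T4.6-ii) FIRST SHELL, NOT `γ`-FIXED ⇒ `τΛ = Λ ∩ γΛ`** (lattices as `𝒪`-submodules, ★ `latt`): under the hypotheses of (T4.6-i),
`latt (δ′·Θ_σ g) = latt g ⊓ latt (Nδ′·g)`.  PROOF: frames `Λ = latt f`, `τΛ = latt (f·ϖ^{e₀})`, `τΛ = latt f′ = latt (F·ϖ^{e₂})`, `γΛ = latt F` (`F = f′·ϖ^{−w₀(1,0,0)}`, §1); `τΛ ≤ Λ ⊓ γΛ ≤
Λ` ⇒ (§0 COATOM at `f`) `Λ ⊓ γΛ ∈ {τΛ, Λ}`; if `= Λ` then `τΛ ≤ Λ ≤ γΛ` ⇒ (COATOM at `F`) `Λ ∈ {τΛ, γΛ}`, but `τΛ ≠ Λ` (`ϖ⁻¹ ∉ 𝒪`) and `γΛ ≠ Λ` (`hne`).  DVR-free, as the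
sheet's `omit`.  (SHEET v2.3 ∕ v2.4 §4 :255, bytes verbatim.) [cite: Macdonald1995, Ch. V §2 (2.6)] [cite: Serre1980Trees, II.1.1] -/
theorem latt_twistFrame_eq_inf_of_mem_twistedShell_one_zero_zero (hvσ : ∀ a, Valued.v (σ a) = Valued.v a) (hσσ : ∀ a, σ (σ a) = a) (hσϖ : σ ϖ = ϖ)
    {δ' g : GL (Fin 3) K}
    (h : g⁻¹ * δ' * UnitaryGroup.qsInvolution σ g ∈
      (glInt 3 K : Set (GL (Fin 3) K)) * {zpowDiagGL hϖ.ne_zero ![1, 0, 0]} * (glInt 3 K : Set (GL (Fin 3) K)))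
    (hne : latt ((δ' * UnitaryGroup.qsInvolution σ δ' * g : GL (Fin 3) K) : Matrix (Fin 3) (Fin 3) K) ≠ latt ((g : GL (Fin 3) K) : Matrix (Fin 3) (Fin 3) K)) :
    latt ((δ' * UnitaryGroup.qsInvolution σ g : GL (Fin 3) K) : Matrix (Fin 3) (Fin 3) K) =
      latt ((g : GL (Fin 3) K) : Matrix (Fin 3) (Fin 3) K) ⊓ latt ((δ' * UnitaryGroup.qsInvolution σ δ' * g : GL (Fin 3) K) : Matrix (Fin 3) (Fin 3) K) := by
  obtain ⟨f, f', hΛ, hτ, hτ', hγ⟩ := exists_frames_of_mem_twistedShell hϖ hvσ hσσ hσϖ h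
  -- the `γ`-side frame `F = f′ ϖ^{−w₀(1,0,0)}`: `γΛ = latt F`, `τΛ = latt (F ϖ^{e₂})`
  have hτF : latt ((δ' * UnitaryGroup.qsInvolution σ g : GL (Fin 3) K) : Matrix (Fin 3) (Fin 3) K) =
      latt ((f' * zpowDiagGL hϖ.ne_zero (fun i => -((![1, 0, 0] : Fin 3 → ℤ) (Fin.rev i))) * zpowDiagGL hϖ.ne_zero (Pi.single 2 1) : GL (Fin 3) K) :
        Matrix (Fin 3) (Fin 3) K) := by
    rw [mul_assoc, ← zpowDiagGL_add, neg_rev_one_zero_zero_add_single, zpowDiagGL_zero, mul_one, hτ']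
  rw [vec_one_zero_zero_eq_single] at hτ
  -- `τΛ ≤ Λ` and `τΛ ≤ γΛ`
  have hτΛ : latt ((δ' * UnitaryGroup.qsInvolution σ g : GL (Fin 3) K) : Matrix (Fin 3) (Fin 3) K) ≤ latt ((g : GL (Fin 3) K) : Matrix (Fin 3) (Fin 3) K) := by
    rw [hτ, hΛ]
    exact latt_mul_zpowDiagGL_single_le hϖ f 0
  have hτγ : latt ((δ' * UnitaryGroup.qsInvolution σ g : GL (Fin 3) K) : Matrix (Fin 3) (Fin 3) K) ≤
      latt ((δ' * UnitaryGroup.qsInvolution σ δ' * g : GL (Fin 3) K) : Matrix (Fin 3) (Fin 3) K) := by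
    rw [hτF, hγ]
    exact latt_mul_zpowDiagGL_single_le hϖ _ 2
  -- COATOM at `f`: `Λ ⊓ γΛ ∈ {τΛ, Λ}`
  rcases eq_or_eq_of_latt_mul_zpowDiagGL_single_le hϖ f 0
      (M := latt ((g : GL (Fin 3) K) : Matrix (Fin 3) (Fin 3) K) ⊓ latt ((δ' * UnitaryGroup.qsInvolution σ δ' * g : GL (Fin 3) K) : Matrix (Fin 3) (Fin 3) K))
      (hτ ▸ le_inf hτΛ hτγ) (hΛ ▸ inf_le_left) with hinf | hinf
  · rw [hinf, hτ]
  · -- `Λ ⊓ γΛ = Λ`: then `τΛ ≤ Λ ≤ γΛ`, contradicting COATOM at `F`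
    exfalso
    have hΛγ : latt ((g : GL (Fin 3) K) : Matrix (Fin 3) (Fin 3) K) ≤ latt ((δ' * UnitaryGroup.qsInvolution σ δ' * g : GL (Fin 3) K) : Matrix (Fin 3) (Fin 3) K) := by
      rw [hΛ, ← hinf]
      exact inf_le_right
    rcases eq_or_eq_of_latt_mul_zpowDiagGL_single_le hϖ _ 2 (M := latt ((g : GL (Fin 3) K) : Matrix (Fin 3) (Fin 3) K)) (hτF ▸ hτΛ) (hγ ▸ hΛγ) with h1 | h2
    · exact latt_mul_zpowDiagGL_single_ne hϖ f 0 (by rw [← hτ, ← hΛ, h1, hτF])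
    · exact hne (by rw [hγ, ← h2])

/-! ## §3 (T4.6-iii) `Λ = τΛ + γ⁻¹τΛ` on the non-split first shell — SHEET v2.3 ∕ v2.4 §4 :268 -/

omit [IsDiscreteValuationRing (ValuativeRel.valuation K).integer] in
/-- **(T4.6-iii) FIRST SHELL, NOT `γ`-FIXED ⇒ `Λ = τΛ + γ⁻¹τΛ`**: the two colength-1 sublattices `τΛ` and `γ⁻¹τΛ ⊂ Λ` are distinct (else `γ` would fix `τΛ`, hence `Λ`), so
they span `Λ`: `latt g = latt (δ′Θ_σ g) ⊔ latt ((Nδ′)⁻¹·δ′Θ_σ g)`.  With (T4.6-ii) this is the parametrisation `Λ ↔ N = τΛ` of the non-split first-shell members on which the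
closed-form count (D1) runs: `Λ = N + γ⁻¹N`, `N = τN′ …`.  PROOF: `γ⁻¹τΛ ≤ γ⁻¹γΛ = Λ` (★ `mapGL_le_mapGL_iff`) and `τΛ ≤ Λ`, so `τΛ ≤ τΛ ⊔ γ⁻¹τΛ ≤ Λ` ⇒ (§0 COATOM) the join
is `τΛ` or `Λ`; if `τΛ`, then `γ⁻¹τΛ ≤ τΛ` with the same covolume (`v det γ = 1`, ★ L1 F3 `v_det_qsInvolution`), so `γ⁻¹τΛ = τΛ` (§0 `latt_eq_latt_of_le_of_v_det_eq`), i.e.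
`τ(γg)·𝒪³ = γ·τΛ = τΛ = τ(g)·𝒪³` (`τ∘γ = γ∘τ` on frames, `Θ_σ² = id`), whence `γΛ = Λ` by `τ`-injectivity (§0) — contradicting `hne`.  DVR-free, as the sheet's `omit`.
(SHEET v2.3 ∕ v2.4 §4 :268, bytes verbatim.) [cite: Macdonald1995, Ch. V §2 (2.6)] [cite: Kottwitz1986BaseChangeUnits, §3] -/
theorem latt_eq_sup_of_mem_twistedShell_one_zero_zero (hvσ : ∀ a, Valued.v (σ a) = Valued.v a) (hσσ : ∀ a, σ (σ a) = a) (hσϖ : σ ϖ = ϖ)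
    {δ' g : GL (Fin 3) K}
    (h : g⁻¹ * δ' * UnitaryGroup.qsInvolution σ g ∈
      (glInt 3 K : Set (GL (Fin 3) K)) * {zpowDiagGL hϖ.ne_zero ![1, 0, 0]} * (glInt 3 K : Set (GL (Fin 3) K)))
    (hne : latt ((δ' * UnitaryGroup.qsInvolution σ δ' * g : GL (Fin 3) K) : Matrix (Fin 3) (Fin 3) K) ≠ latt ((g : GL (Fin 3) K) : Matrix (Fin 3) (Fin 3) K)) :
    latt ((g : GL (Fin 3) K) : Matrix (Fin 3) (Fin 3) K) =
      latt ((δ' * UnitaryGroup.qsInvolution σ g : GL (Fin 3) K) : Matrix (Fin 3) (Fin 3) K) ⊔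
        latt (((δ' * UnitaryGroup.qsInvolution σ δ')⁻¹ * (δ' * UnitaryGroup.qsInvolution σ g) : GL (Fin 3) K) : Matrix (Fin 3) (Fin 3) K) := by
  obtain ⟨f, f', hΛ, hτ, hτ', hγ⟩ := exists_frames_of_mem_twistedShell hϖ hvσ hσσ hσϖ h
  have hτF : latt ((δ' * UnitaryGroup.qsInvolution σ g : GL (Fin 3) K) : Matrix (Fin 3) (Fin 3) K) =
      latt ((f' * zpowDiagGL hϖ.ne_zero (fun i => -((![1, 0, 0] : Fin 3 → ℤ) (Fin.rev i))) * zpowDiagGL hϖ.ne_zero (Pi.single 2 1) : GL (Fin 3) K) :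
        Matrix (Fin 3) (Fin 3) K) := by
    rw [mul_assoc, ← zpowDiagGL_add, neg_rev_one_zero_zero_add_single, zpowDiagGL_zero, mul_one, hτ']
  rw [vec_one_zero_zero_eq_single] at hτ
  -- `τΛ ≤ Λ`, `τΛ ≤ γΛ`, hence `γ⁻¹τΛ ≤ Λ`
  have hτΛ : latt ((δ' * UnitaryGroup.qsInvolution σ g : GL (Fin 3) K) : Matrix (Fin 3) (Fin 3) K) ≤ latt ((g : GL (Fin 3) K) : Matrix (Fin 3) (Fin 3) K) := by
    rw [hτ, hΛ]
    exact latt_mul_zpowDiagGL_single_le hϖ f 0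
  have hτγ : latt ((δ' * UnitaryGroup.qsInvolution σ g : GL (Fin 3) K) : Matrix (Fin 3) (Fin 3) K) ≤
      latt ((δ' * UnitaryGroup.qsInvolution σ δ' * g : GL (Fin 3) K) : Matrix (Fin 3) (Fin 3) K) := by
    rw [hτF, hγ]
    exact latt_mul_zpowDiagGL_single_le hϖ _ 2
  have hγτΛ : latt (((δ' * UnitaryGroup.qsInvolution σ δ')⁻¹ * (δ' * UnitaryGroup.qsInvolution σ g) : GL (Fin 3) K) : Matrix (Fin 3) (Fin 3) K) ≤
      latt ((g : GL (Fin 3) K) : Matrix (Fin 3) (Fin 3) K) := by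
    rw [← mapGL_latt, ← mapGL_le_mapGL_iff (δ' * UnitaryGroup.qsInvolution σ δ'), ← mapGL_mul, mul_inv_cancel, mapGL_one, mapGL_latt]
    exact hτγ
  -- COATOM at `f`: `τΛ ⊔ γ⁻¹τΛ ∈ {τΛ, Λ}`
  rcases eq_or_eq_of_latt_mul_zpowDiagGL_single_le hϖ f 0
      (M := latt ((δ' * UnitaryGroup.qsInvolution σ g : GL (Fin 3) K) : Matrix (Fin 3) (Fin 3) K) ⊔
        latt (((δ' * UnitaryGroup.qsInvolution σ δ')⁻¹ * (δ' * UnitaryGroup.qsInvolution σ g) : GL (Fin 3) K) : Matrix (Fin 3) (Fin 3) K))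
      (hτ ▸ le_sup_left) (hΛ ▸ sup_le hτΛ hγτΛ) with hsup | hsup
  · -- the join is `τΛ`: then `γ⁻¹τΛ ≤ τΛ` with the same covolume, so `γ⁻¹τΛ = τΛ`, so `γ` fixes `τΛ` and hence `Λ`
    exfalso
    have hle : latt (((δ' * UnitaryGroup.qsInvolution σ δ')⁻¹ * (δ' * UnitaryGroup.qsInvolution σ g) : GL (Fin 3) K) : Matrix (Fin 3) (Fin 3) K) ≤
        latt ((δ' * UnitaryGroup.qsInvolution σ g : GL (Fin 3) K) : Matrix (Fin 3) (Fin 3) K) := by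
      rw [hτ, ← hsup]
      exact le_sup_right
    have hδ : Valued.v ((δ' : GL (Fin 3) K) : Matrix (Fin 3) (Fin 3) K).det ≠ 0 := (Valuation.ne_zero_iff _).2 (Matrix.isUnits_det_units δ').ne_zero
    have hdet : Valued.v (((δ' * UnitaryGroup.qsInvolution σ δ')⁻¹ * (δ' * UnitaryGroup.qsInvolution σ g) : GL (Fin 3) K) : Matrix (Fin 3) (Fin 3) K).det =
        Valued.v ((δ' * UnitaryGroup.qsInvolution σ g : GL (Fin 3) K) : Matrix (Fin 3) (Fin 3) K).det := by
      rw [Units.val_mul ((δ' * UnitaryGroup.qsInvolution σ δ')⁻¹), Matrix.det_mul, map_mul, Matrix.coe_units_inv, Matrix.det_nonsing_inv, Ring.inverse_eq_inv',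
        map_inv₀, Units.val_mul δ', Matrix.det_mul, map_mul, v_det_qsInvolution hvσ, mul_inv_cancel₀ hδ, inv_one, one_mul]
    have heq := latt_eq_latt_of_le_of_v_det_eq _ _ hle hdet
    -- `γ⁻¹τΛ = τΛ` ⟹ `τ(γ g)·𝒪³ = γ·τΛ = τΛ`
    have hγτ : latt ((δ' * UnitaryGroup.qsInvolution σ (δ' * UnitaryGroup.qsInvolution σ δ' * g) : GL (Fin 3) K) : Matrix (Fin 3) (Fin 3) K) =
        latt ((δ' * UnitaryGroup.qsInvolution σ g : GL (Fin 3) K) : Matrix (Fin 3) (Fin 3) K) := by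
      have hc : δ' * UnitaryGroup.qsInvolution σ (δ' * UnitaryGroup.qsInvolution σ δ' * g) =
          (δ' * UnitaryGroup.qsInvolution σ δ') * (δ' * UnitaryGroup.qsInvolution σ g) := by
        simp only [UnitaryGroup.qsInvolution_mul, qsInvolution_qsInvolution hσσ]
        group
      rw [hc, ← mapGL_latt, ← heq, mapGL_latt, mul_inv_cancel_left]
      exact heq.symm
    exact hne ((latt_twistFrame_eq_latt_twistFrame_iff hvσ δ' _ _).1 hγτ)
  · rw [hΛ, ← hsup]

end FirstShell

end Summit.HodgeConjecture.HodgeConjecture.R90.S6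

end
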